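import Mathlib
import HarnessLib
import Summits.ABC.ABC.Theses.CongruentialReceptacle
import Summits.ABC.ABC.Theorems.CompactBalanceTransfer.Negative.CuspWeightedResidueFree

/-!
# `CompactBalanceTransfer` (stmt-ABC-1725), line `Sketch` — the cusp defect of the stub cannot be lowered

Negative-lane lemma by the crux disprover (`refuter-cdisprove-stmt-ABC-1725-0`, 2026-08-16) on the single stub
`CuspWeightedReceptacle` of the picked line `Sketch` (`Cruxes/CompactBalanceTransfer/Lines/Sketch.lean`): integer
tables `t(p; v_p a, v_p b, v_p c; a′, b′, c′ mod p)` WITH unit residues, lower window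
`c₁ (v_p c − 1 − ε) log p ≤ t`, upper window `|t| ≤ c₁′ (v_p a + v_p b + v_p c + 1) log p`, and
`Σ_{p ∣ abc} t ≡ B (mod ℓⁿ)`, `|B| ≤ c₃`, on every abc-triple prime to `ℓ`.

The `−1` in the lower window is the CUSP DEFECT: summed over `p ∣ abc` the lower windows give
`c₁ (log c − (1+ε) log rad(abc))`, so the stub is abc-strength exactly (`abc_of_cuspWeightedReceptacle` in the
line file; the lead's `Negative/StrengthSzpiroToAbc.lean`). This file proves that the defect cannot be taken any
smaller, EVEN FOR RESIDUE-DEPENDENT TABLES: with lower window `c₁ (v_p c − δ − ε) log p` the receptacle is false as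
soon as `δ + ε < 1` (`cuspWeighted_defect_false`), hence the `δ`-variant of the stub is false for every `δ < 1`
(`not_cuspWeightedReceptacle_of_defect_lt_one`). Certificate: the single Mersenne triple `(1, 2ᵏ − 1, 2ᵏ)`, whose
radical is `2·rad(2ᵏ − 1) ≤ 2^{k+1}`; reading its congruence at a prime `ℓ` above the product and a modulus `ℓⁿ`
above the a-priori window bound makes it an identity `S = B`, `|B| ≤ c₃`, while the lower windows alone (no
cancellation, so the residues are irrelevant) give `S ≥ c₁ (k log 2 − (δ+ε)(k+1) log 2) → ∞`.

Together with the lead's refutation of the residue-FREE form at `δ = 1` and the disprover's slope-LP report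
(`Cruxes/CompactBalanceTransfer/Disproof.lean` §4: no signed polynomial-identity family does better than a single
triple against residue-dependent tables, critical ratio `A* = 1/2`), this locates the stub exactly on the quality-1
line: one-triple certificates stop at `δ = 1`, and nothing found goes beyond them.
-/

-- `Summit.<Summit>.<Problem>`: for the single-conjunct summit `ABC` the duplicate `ABC.ABC` is mandated.
set_option linter.dupNamespace false

namespace Summit.ABC.ABC.Theorems.CompactBalanceTransfer.Negative

open Literature.NumberTheory.DiophantineGeometry

/-- **A cusp defect `δ + ε < 1` is contradictory, residues or not.** If for every prime `ℓ ≥ 5` and `n` with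
`ℓⁿ ≥ m₀` there were a residue-dependent integer table with lower window `c₁ (v_p c − δ − ε) log p ≤ t`, the usual
upper window and bounded congruent sums on all abc-triples prime to `ℓ`, then `False`: the Mersenne triple
`(1, 2ᵏ − 1, 2ᵏ)` with `c₁ log 2 · (k(1−μ) − μ) > |c₃|`, `μ = max(δ+ε, 0) < 1`. [folklore] -/
theorem cuspWeighted_defect_false (δ ε c₁ c₁' c₃ : ℝ) (hδε : δ + ε < 1) (hc₁ : 0 < c₁) (m₀ : ℕ)
    (H : ∀ ℓ n : ℕ, ℓ.Prime → 5 ≤ ℓ → m₀ ≤ ℓ ^ n →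
      ∃ t : ℕ → ℕ → ℕ → ℕ → ℕ → ℕ → ℕ → ℤ,
        (∀ p i j k r s z : ℕ, p.Prime →
          c₁ * (((k : ℕ) : ℝ) - δ - ε) * Real.log p ≤ (t p i j k r s z : ℝ) ∧
          |(t p i j k r s z : ℝ)| ≤ c₁' * (((i + j + k : ℕ) : ℝ) + 1) * Real.log p) ∧
        ∀ a b c : ℕ, IsABCTriple a b c → ¬ ℓ ∣ a * b * c →
          ∃ B : ℤ, |(B : ℝ)| ≤ c₃ ∧
            (∑ p ∈ (a * b * c).primeFactors,
                t p (a.factorization p) (b.factorization p) (c.factorization p)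
                  (a / p ^ a.factorization p % p) (b / p ^ b.factorization p % p)
                  (c / p ^ c.factorization p % p)) ≡ B [ZMOD ((ℓ ^ n : ℕ) : ℤ)]) :
    False := by
  have hlog2 : (0 : ℝ) < Real.log 2 := Real.log_pos (by norm_num)
  -- μ = max (δ + ε) 0 ∈ [0, 1)
  set μ : ℝ := max (δ + ε) 0 with hμ
  have hμ0 : 0 ≤ μ := le_max_right _ _
  have hμ1 : μ < 1 := max_lt hδε one_pos
  have hδμ : δ + ε ≤ μ := le_max_left _ _
  have h1μ : 0 < 1 - μ := by linarith
  -- the exponent k: c₁ log 2 (k (1 - μ) - μ) > |c₃|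
  set A : ℝ := (|c₃| / (c₁ * Real.log 2) + μ) / (1 - μ) with hA
  set k : ℕ := ⌈A⌉₊ + 1 with hk
  have hk1 : 1 ≤ k := by omega
  have hkA : A < (k : ℝ) := by
    rw [hk]; push_cast; linarith [Nat.le_ceil A]
  have hkey : |c₃| < c₁ * Real.log 2 * ((k : ℝ) * (1 - μ) - μ) := by
    have hpos : 0 < c₁ * Real.log 2 := mul_pos hc₁ hlog2
    have h1 : |c₃| / (c₁ * Real.log 2) + μ < (k : ℝ) * (1 - μ) := by
      rw [hA, div_lt_iff₀ h1μ] at hkA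
      linarith
    have h2 : |c₃| / (c₁ * Real.log 2) < (k : ℝ) * (1 - μ) - μ := by linarith
    rw [div_lt_iff₀ hpos] at h2
    linarith
  -- the Mersenne triple (1, M, N), N = 2^k, M = N - 1
  set N : ℕ := 2 ^ k with hN
  have hN2 : 2 ≤ N := by
    rw [hN]
    calc (2 : ℕ) = 2 ^ 1 := by norm_num
      _ ≤ 2 ^ k := Nat.pow_le_pow_right (by norm_num) hk1
  set M : ℕ := N - 1 with hM
  have hM0 : 0 < M := by omega
  have hN0 : 0 < N := by omega
  have hNeven : N % 2 = 0 := by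
    have : Even N := by rw [hN]; exact (Nat.even_pow).mpr ⟨even_two, by omega⟩
    exact Nat.even_iff.mp this
  have h2M : ¬ 2 ∣ M := by omega
  have habc : IsABCTriple 1 M N := ⟨one_pos, hM0, by omega, Nat.coprime_one_left M⟩
  set Q : ℕ := 1 * M * N with hQ
  have hQ0 : 0 < Q := by positivity
  -- the prime ℓ above the product
  obtain ⟨ℓ, hℓge, hℓp⟩ := Nat.exists_infinite_primes (Q + 5)
  have h5 : 5 ≤ ℓ := by omega
  have hℓQ : ¬ ℓ ∣ Q := by
    intro h
    have := Nat.le_of_dvd hQ0 h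
    omega
  -- a-priori bound Z and the exponent n
  set Z : ℝ := ∑ p ∈ Q.primeFactors,
    |c₁'| * ((((1 : ℕ).factorization p + M.factorization p + N.factorization p : ℕ) : ℝ) + 1) * Real.log p
    with hZ
  have hZ0 : 0 ≤ Z := by
    refine Finset.sum_nonneg fun p hp => ?_
    have hp := (Nat.prime_of_mem_primeFactors hp).one_lt
    have : 0 ≤ Real.log p := Real.log_nonneg (by exact_mod_cast hp.le)
    positivity
  set n : ℕ := m₀ + ⌈2 * Z⌉₊ + ⌈2 * |c₃|⌉₊ + 1 with hn
  have hnlt : n < ℓ ^ n := Nat.lt_pow_self (by omega)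
  have hm₀ : m₀ ≤ ℓ ^ n := by omega
  have hpowR : (n : ℝ) < ((ℓ ^ n : ℕ) : ℝ) := by exact_mod_cast hnlt
  have hnR : Z + |c₃| < (n : ℝ) := by
    rw [hn]
    push_cast
    linarith [Nat.le_ceil (2 * Z), Nat.le_ceil (2 * |c₃|), (Nat.cast_nonneg m₀ : (0 : ℝ) ≤ m₀), abs_nonneg c₃]
  -- table, congruence, equality
  obtain ⟨t, ht, hT⟩ := H ℓ n hℓp h5 hm₀
  obtain ⟨B, hB, hcong⟩ := hT 1 M N habc hℓQ
  set S : ℤ := ∑ p ∈ Q.primeFactors,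
    t p ((1 : ℕ).factorization p) (M.factorization p) (N.factorization p)
      (1 / p ^ (1 : ℕ).factorization p % p) (M / p ^ M.factorization p % p) (N / p ^ N.factorization p % p)
    with hS
  have hSabs : |(S : ℝ)| ≤ Z := by
    rw [hS, Int.cast_sum, hZ]
    refine (Finset.abs_sum_le_sum_abs _ _).trans ?_
    refine Finset.sum_le_sum fun p hp => ?_
    have hpp := Nat.prime_of_mem_primeFactors hp
    have h := (ht p ((1 : ℕ).factorization p) (M.factorization p) (N.factorization p)
      (1 / p ^ (1 : ℕ).factorization p % p) (M / p ^ M.factorization p % p) (N / p ^ N.factorization p % p) hpp).2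
    have hlog : 0 ≤ Real.log p := Real.log_nonneg (by exact_mod_cast hpp.one_lt.le)
    have h0 : (0 : ℝ) ≤ ((((1 : ℕ).factorization p + M.factorization p + N.factorization p : ℕ) : ℝ) + 1)
        * Real.log p := by positivity
    have := mul_le_mul_of_nonneg_right (le_abs_self c₁') h0
    linarith
  have hBabs : |(B : ℝ)| ≤ |c₃| := hB.trans (le_abs_self c₃)
  have hSB : S = B :=
    eq_of_modEq_of_abs_le hcong hSabs hBabs (by linarith)
  have hSle : (S : ℝ) ≤ |c₃| := by
    rw [hSB]; exact (le_abs_self _).trans hBabs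
  -- lower windows: S ≥ c₁ (log N − (δ+ε) log rad)
  have hsub : N.primeFactors ⊆ Q.primeFactors :=
    Nat.primeFactors_mono (dvd_mul_left N (1 * M)) hQ0.ne'
  have hlogC : ∑ p ∈ Q.primeFactors, ((N.factorization p : ℕ) : ℝ) * Real.log p = Real.log N := by
    rw [Real.log_nat_eq_sum_factorization, Finsupp.sum, Nat.support_factorization]
    symm
    refine Finset.sum_subset hsub ?_
    intro p hpQ hpN
    have pp := Nat.prime_of_mem_primeFactors hpQ
    have hndvd : ¬ p ∣ N := fun h => hpN (Nat.mem_primeFactors.mpr ⟨pp, h, hN0.ne'⟩)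
    simp [Nat.factorization_eq_zero_of_not_dvd hndvd]
  have hRpos : 0 < rad 1 M N := by
    rw [rad_def]; exact Nat.pos_of_ne_zero UniqueFactorizationMonoid.radical_ne_zero
  have hlogR : ∑ p ∈ Q.primeFactors, Real.log p = Real.log ((rad 1 M N : ℕ) : ℝ) := by
    rw [rad_def, ← hQ, Nat.radical_eq_prod_primeFactors, Nat.cast_prod, Real.log_prod]
    intro p hp
    exact_mod_cast (Nat.prime_of_mem_primeFactors hp).ne_zero
  have hSlow : c₁ * (Real.log N - (δ + ε) * Real.log ((rad 1 M N : ℕ) : ℝ)) ≤ (S : ℝ) := by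
    have h1 : ∑ p ∈ Q.primeFactors, c₁ * (((N.factorization p : ℕ) : ℝ) - δ - ε) * Real.log p ≤ (S : ℝ) := by
      rw [hS, Int.cast_sum]
      refine Finset.sum_le_sum fun p hp => ?_
      exact (ht p _ _ _ _ _ _ (Nat.prime_of_mem_primeFactors hp)).1
    have h2 : ∑ p ∈ Q.primeFactors, c₁ * (((N.factorization p : ℕ) : ℝ) - δ - ε) * Real.log p
        = c₁ * (Real.log N - (δ + ε) * Real.log ((rad 1 M N : ℕ) : ℝ)) := by
      rw [← hlogC, ← hlogR, Finset.mul_sum, ← Finset.sum_sub_distrib, Finset.mul_sum]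
      refine Finset.sum_congr rfl fun p _ => ?_
      ring
    linarith
  -- the radical of the Mersenne triple: rad(1·M·N) = 2·rad(M) ≤ 2M < 2^(k+1)
  have hradle : rad 1 M N ≤ 2 ^ (k + 1) := by
    rw [rad_def, ← hQ, Nat.radical_eq_prod_primeFactors]
    have hk0 : k ≠ 0 := by omega
    have hpf : Q.primeFactors = M.primeFactors ∪ {2} := by
      rw [hQ, one_mul, Nat.primeFactors_mul hM0.ne' hN0.ne', hN, Nat.primeFactors_pow _ hk0,
        Nat.Prime.primeFactors Nat.prime_two]
    have hdisj : Disjoint M.primeFactors ({2} : Finset ℕ) := by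
      rw [Finset.disjoint_singleton_right]
      intro h
      exact h2M (Nat.dvd_of_mem_primeFactors h)
    rw [hpf, Finset.prod_union hdisj, Finset.prod_singleton]
    have hprodM : ∏ p ∈ M.primeFactors, p ≤ M := Nat.le_of_dvd hM0 (Nat.prod_primeFactors_dvd M)
    calc (∏ p ∈ M.primeFactors, p) * 2 ≤ M * 2 := Nat.mul_le_mul_right 2 hprodM
      _ ≤ N * 2 := Nat.mul_le_mul_right 2 (by omega)
      _ = 2 ^ (k + 1) := by rw [hN]; exact (pow_succ 2 k).symm
  have hlogRle : Real.log ((rad 1 M N : ℕ) : ℝ) ≤ ((k : ℝ) + 1) * Real.log 2 := by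
    have h1 : ((rad 1 M N : ℕ) : ℝ) ≤ ((2 ^ (k + 1) : ℕ) : ℝ) := by exact_mod_cast hradle
    have h2 : Real.log ((rad 1 M N : ℕ) : ℝ) ≤ Real.log ((2 ^ (k + 1) : ℕ) : ℝ) :=
      Real.log_le_log (by exact_mod_cast hRpos) h1
    have h3 : Real.log ((2 ^ (k + 1) : ℕ) : ℝ) = ((k : ℝ) + 1) * Real.log 2 := by
      push_cast
      rw [Real.log_pow]
      push_cast
      ring
    linarith
  have hlogR0 : 0 ≤ Real.log ((rad 1 M N : ℕ) : ℝ) :=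
    Real.log_nonneg (by exact_mod_cast hRpos)
  have hlogN : Real.log (N : ℝ) = (k : ℝ) * Real.log 2 := by
    rw [hN]; push_cast; rw [Real.log_pow]
  -- combine
  have hmid : c₁ * Real.log 2 * ((k : ℝ) * (1 - μ) - μ)
      ≤ c₁ * (Real.log N - (δ + ε) * Real.log ((rad 1 M N : ℕ) : ℝ)) := by
    rw [hlogN]
    have h1 : (δ + ε) * Real.log ((rad 1 M N : ℕ) : ℝ) ≤ μ * (((k : ℝ) + 1) * Real.log 2) := by
      calc (δ + ε) * Real.log ((rad 1 M N : ℕ) : ℝ) ≤ μ * Real.log ((rad 1 M N : ℕ) : ℝ) :=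
            mul_le_mul_of_nonneg_right hδμ hlogR0
        _ ≤ μ * (((k : ℝ) + 1) * Real.log 2) := mul_le_mul_of_nonneg_left hlogRle hμ0
    have h2 : c₁ * Real.log 2 * ((k : ℝ) * (1 - μ) - μ)
        = c₁ * ((k : ℝ) * Real.log 2 - μ * (((k : ℝ) + 1) * Real.log 2)) := by ring
    rw [h2]
    exact mul_le_mul_of_nonneg_left (by linarith) hc₁.le
  linarith

/-- **The cusp defect of the stub is critical.** For every `δ < 1` the `δ`-variant of `CuspWeightedReceptacle`
(lower window `c₁ (v_p c − δ − ε) log p`, residue-DEPENDENT tables) is false; at `δ = 1` it is the stub itself,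
which is `≥ ABC` and open. (Take `ε = (1 − δ)/2` in `cuspWeighted_defect_false`.) [folklore] -/
theorem not_cuspWeightedReceptacle_of_defect_lt_one {δ : ℝ} (hδ : δ < 1) :
    ¬ (∀ ε : ℝ, 0 < ε → ∃ c₁ c₁' c₃ : ℝ, 0 < c₁ ∧ ∃ m₀ : ℕ, ∀ ℓ n : ℕ, ℓ.Prime → 5 ≤ ℓ → m₀ ≤ ℓ ^ n →
      ∃ t : ℕ → ℕ → ℕ → ℕ → ℕ → ℕ → ℕ → ℤ,
        (∀ p i j k r s z : ℕ, p.Prime →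
          c₁ * (((k : ℕ) : ℝ) - δ - ε) * Real.log p ≤ (t p i j k r s z : ℝ) ∧
          |(t p i j k r s z : ℝ)| ≤ c₁' * (((i + j + k : ℕ) : ℝ) + 1) * Real.log p) ∧
        ∀ a b c : ℕ, IsABCTriple a b c → ¬ ℓ ∣ a * b * c →
          ∃ B : ℤ, |(B : ℝ)| ≤ c₃ ∧
            (∑ p ∈ (a * b * c).primeFactors,
                t p (a.factorization p) (b.factorization p) (c.factorization p)
                  (a / p ^ a.factorization p % p) (b / p ^ b.factorization p % p)
                  (c / p ^ c.factorization p % p)) ≡ B [ZMOD ((ℓ ^ n : ℕ) : ℤ)]) := by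
  intro H
  have hε : 0 < (1 - δ) / 2 := by linarith
  obtain ⟨c₁, c₁', c₃, hc₁, m₀, H⟩ := H ((1 - δ) / 2) hε
  exact cuspWeighted_defect_false δ ((1 - δ) / 2) c₁ c₁' c₃ (by linarith) hc₁ m₀ H

end Summit.ABC.ABC.Theorems.CompactBalanceTransfer.Negative
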